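import Summits.HubbardSuperconductivity.HubbardSuperconductivity.Theses.SignStructure
import Literature.MathematicalPhysics.QuantumLattice.PairCorrelationsProofs

/-!
# Route `SignStructure` — glue support `ShadowTransfer` (stmt-HubbardSuperconductivity-14443)

`ShadowTransfer : JastrowSlaterNoDWaveLRO → JastrowSlaterShadow → Target` (cruxes ⇒ target of
this ABSENCE route). Fix `U > 0`, `δ ∈ (0, 1/2)`; the shadow gives an admissible sequence `(N, ψ)`
and fixed-weight Jastrow–Slater data `(r, g, N', φ)` with `F_d(ψ_{L+1}) - F_d(χ_{L+1}) → 0`, where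
`F_d(·) = re ⟨·, Δ_dᴴ Δ_d ·⟩ / (re ⟨·,·⟩ (L+1)⁴)`; the no-LRO crux at the same data gives
`F_d(χ_{L+1}) → 0` for the syntactically identical `χ`-term, so `F_d(ψ_{L+1}) → 0`. Offer `(N, ψ)`
as the target's witness: the summit's LRO sequence at `k = j + 1` is
`re ⟨ψ_{2j+2}, Δ_dᴴ Δ_d ψ_{2j+2}⟩ / (2j+2)⁴ = F_d(ψ_{(2j+1)+1})` (`torusLROSeq_pairFieldCorr_succ`,
`‖ψ‖ = 1` at even sides), which tends to `0` along `j ↦ 2j + 1`, so its `liminf` is `0`, not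
positive. Even-side bookkeeping only; no analysis, no new definitions. Sources: D. J. Scalapino,
Phys. Rep. 250 (1995) 329, §2; C. N. Yang, Rev. Mod. Phys. 34 (1962) 694.
-/

-- the mandated namespace `Summit.<Summit>.<Problem>.Theorems` repeats `HubbardSuperconductivity`
-- (single-problem summit, D-0017), which the `dupNamespace` linter flags on every declaration
set_option linter.dupNamespace false

namespace Summit.HubbardSuperconductivity.HubbardSuperconductivity.Theorems

open Matrix Filter
open Literature.MathematicalPhysics.QuantumLattice Literature.Probability.LatticeModels

/-- `a - b → 0` and `b → 0` give `a → 0` (real sequences). [folklore] -/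
theorem tendsto_zero_of_sub_of_tendsto_zero {a b : ℕ → ℝ}
    (h1 : Tendsto (fun L => a L - b L) atTop (nhds 0)) (h2 : Tendsto b atTop (nhds 0)) :
    Tendsto a atTop (nhds 0) := by
  have h := h1.add h2
  rw [add_zero] at h
  refine h.congr' (Eventually.of_forall fun L => ?_)
  show a L - b L + b L = a L
  ring

/-- **No even-side LRO from a vanishing normalised pair functional.** If
`F(L) = re ⟨ψ_{L+1}, Δ_dᴴ Δ_d ψ_{L+1}⟩ / (re ⟨ψ_{L+1}, ψ_{L+1}⟩ · (L+1)⁴) → 0` and `ψ` is normalised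
at the even sides `2j + 2`, then the summit's LRO sequence of `ψ` tends to `0` (its `(j+1)`-st term
is `F(2j+1)`), hence has no positive `liminf`. [folklore] -/
theorem not_hasLongRangeOrder_of_tendsto_zero (ψ : ∀ L, Fock (Orb (FermionTorus 2 L)))
    (hnorm : ∀ j : ℕ, star (ψ (2 * j + 1 + 1)) ⬝ᵥ ψ (2 * j + 1 + 1) = 1)
    (hF : Tendsto (fun L : ℕ =>
      (expect ((pairField dWaveFormFactor (L + 1))ᴴ * pairField dWaveFormFactor (L + 1))
          (ψ (L + 1))).re /
        ((star (ψ (L + 1)) ⬝ᵥ ψ (L + 1)).re * ((L + 1 : ℕ) : ℝ) ^ 4)) atTop (nhds 0)) :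
    ¬ HasLongRangeOrder (fun k => halfOpenBox 2 (2 * k))
        (fun k => torusPullback (pairFieldCorr dWaveFormFactor ψ) (2 * k)) := by
  intro hLRO
  change 0 < liminf (fun k : ℕ => (∑ x ∈ halfOpenBox 2 (2 * k), ∑ y ∈ halfOpenBox 2 (2 * k),
          torusPullback (pairFieldCorr dWaveFormFactor ψ) (2 * k) x y) /
        ((halfOpenBox 2 (2 * k)).card : ℝ) ^ 2) atTop at hLRO
  set t : ℕ → ℝ := fun k : ℕ => (∑ x ∈ halfOpenBox 2 (2 * k), ∑ y ∈ halfOpenBox 2 (2 * k),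
          torusPullback (pairFieldCorr dWaveFormFactor ψ) (2 * k) x y) /
        ((halfOpenBox 2 (2 * k)).card : ℝ) ^ 2 with ht_def
  -- the shifted LRO sequence is F along the odd subsequence 2j+1
  have hshift : ∀ j : ℕ, t (j + 1) =
      (expect ((pairField dWaveFormFactor (2 * j + 1 + 1))ᴴ *
          pairField dWaveFormFactor (2 * j + 1 + 1)) (ψ (2 * j + 1 + 1))).re /
        ((star (ψ (2 * j + 1 + 1)) ⬝ᵥ ψ (2 * j + 1 + 1)).re * ((2 * j + 1 + 1 : ℕ) : ℝ) ^ 4) := by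
    intro j
    rw [hnorm j, Complex.one_re, one_mul]
    exact torusLROSeq_pairFieldCorr_succ dWaveFormFactor ψ (2 * j + 1)
  have hodd : Tendsto (fun j : ℕ => 2 * j + 1) atTop atTop :=
    tendsto_atTop_atTop.2 fun b => ⟨b, fun j hj => by omega⟩
  have hcomp : Tendsto (fun j : ℕ => t (j + 1)) atTop (nhds 0) := by
    have h := hF.comp hodd
    refine h.congr' (Eventually.of_forall fun j => ?_)
    show _ = t (j + 1)
    rw [hshift j]
    rfl
  have htend : Tendsto t atTop (nhds 0) := (tendsto_add_atTop_iff_nat 1).1 hcomp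
  rw [htend.liminf_eq] at hLRO
  exact lt_irrefl _ hLRO

/-- **ShadowTransfer** (item `stmt-HubbardSuperconductivity-14443`):
`JastrowSlaterNoDWaveLRO → JastrowSlaterShadow → Target`. [folklore] -/
theorem shadowTransfer_proof :
    Summit.HubbardSuperconductivity.HubbardSuperconductivity.Theses.SignStructure.ShadowTransfer := by
  intro hNo hSh U hU δ hδ
  obtain ⟨N, ψ, hadm, r, g, hg, N', φ, hT⟩ := hSh U hU δ hδ
  have hχ := hNo r g hg N' φ
  refine ⟨N, ψ, hadm, ?_⟩
  have hF := tendsto_zero_of_sub_of_tendsto_zero hT hχ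
  refine not_hasLongRangeOrder_of_tendsto_zero ψ (fun j => ?_) hF
  exact (hadm (2 * (j + 1)) (even_two_mul (j + 1))).2.1

end Summit.HubbardSuperconductivity.HubbardSuperconductivity.Theorems
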